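import Mathlib
import HarnessLib
import Literature.Analysis.FluidPDE.ClassicalSolution
import Literature.Analysis.FluidPDE.LerayHopf
import Literature.Analysis.FluidPDE.LerayHopfConcatenation
import Literature.Analysis.FluidPDE.NSBoundedMildOseenClassical
import Summits.NavierStokesRegularity.NavierStokesRegularity.Theses.QuarterJolt
import Summits.NavierStokesRegularity.NavierStokesRegularity.Theorems.QuarterJoltRegularTerminalValueJolts

/-!
# Route QuarterJolt — crux `NoTerminalJolt` (stmt-NavierStokesRegularity-26463), LEAD line
# `regular_split` rev 4: ROUGH TERMINAL PROFILES — the divergence-free hypothesis is automatic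

Seat ns-ntj-p1 g3 (LEAD of the crux; `--supports 26463 --as helper`), a short sequel of
`QuarterJoltRegularTerminalValueJolts.lean` (p635366). There, a first blow-up whose Leray–Hopf
terminal value `u(T)` is smooth, bounded, DIVERGENCE FREE and has `Du(T) ∈ L²` was shown to jolt. The
divergence-free hypothesis is automatic: the final slice of a Leray–Hopf solution is weakly divergence
free (`IsLerayHopfOn.isWeaklyDivFree_final`: `u(T)` is the weak `L²` limit of the divergence-free
slices, Robinson–Rodrigo–Sadowski 2016 Cor. 3.9), and a `C¹` weakly divergence-free field is
divergence free (`IsWeaklyDivFree.isDivFree_of_contDiff`, du Bois-Reymond). Hence: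

* `isDivFree_terminalValue` — in the frame, a `C¹` terminal value is divergence free;
* `jolt_of_smoothTerminalValue` — a first blow-up in the frame whose terminal value is smooth and
  bounded with `Du(T) ∈ L²` JOLTS;
* `not_smoothTerminalValue_of_noTerminalJolt` — the crux BY NAME ⇒ at every first blow-up time of
  every frame solution, `u(T)` is NOT a smooth bounded field with square-integrable gradient:
  «no terminal jolt ⇒ blow-ups leave ROUGH terminal profiles».

HONEST FRAMING: statements about HYPOTHETICAL first blow-ups; nothing here proves `NoTerminalJolt`,
excludes blow-up, or proves Navier–Stokes regularity. No summit statement is proved here. [folklore]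
-/

noncomputable section

-- the summit and its single sub-problem share the name (CONVENTIONS §1), as in every Theorems file
set_option linter.dupNamespace false

namespace Summit.NavierStokesRegularity.NavierStokesRegularity.Theorems

open MeasureTheory Set Function Filter Topology
open scoped ENNReal NNReal ContDiff
open Literature.Analysis.FluidPDE

namespace NoTerminalJolt

/-- **The terminal value of a Leray–Hopf solution is divergence free as soon as it is `C¹`**
(`IsLerayHopfOn.isWeaklyDivFree_final` + `IsWeaklyDivFree.isDivFree_of_contDiff`).
[cite: RobinsonRodrigoSadowski2016, Cor. 3.9] -/
theorem isDivFree_terminalValue {ν T : ℝ} (hT : 0 < T)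
    {f : ℝ → EuclideanSpace ℝ (Fin 3) → EuclideanSpace ℝ (Fin 3)}
    {u₀ : EuclideanSpace ℝ (Fin 3) → EuclideanSpace ℝ (Fin 3)}
    {u : ℝ → EuclideanSpace ℝ (Fin 3) → EuclideanSpace ℝ (Fin 3)} (hLH : IsLerayHopfOn T ν f u₀ u)
    (hU : ContDiff ℝ 1 (u T)) : VectorCalculus.IsDivFree (u T) :=
  (hLH.isWeaklyDivFree_final hT).isDivFree_of_contDiff hU

/-- **A first blow-up with a SMOOTH terminal value jolts** (`jolt_of_regularTerminalValue` with the
divergence-free hypothesis discharged): a maximal classical solution on `[0,T)` (`ν, T > 0`),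
Leray–Hopf on `[0,T]` from a rapidly decaying datum, whose terminal value `u(T)` is smooth and bounded
with `Du(T) ∈ L²`, has a jolt functional that does not tend to `0`. [folklore] -/
theorem jolt_of_smoothTerminalValue {ν T : ℝ} (hν : 0 < ν) (hT : 0 < T)
    {u : ℝ → EuclideanSpace ℝ (Fin 3) → EuclideanSpace ℝ (Fin 3)} {p : ℝ → EuclideanSpace ℝ (Fin 3) → ℝ}
    (hmax : IsMaximalSmoothSolution ν 0 u p T) (hLH : IsLerayHopfOn T ν 0 (u 0) u)
    (hdec : HasRapidSpatialDecay (u 0))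
    (hUs : ContDiff ℝ ∞ (u T)) (hL : ∃ L : ℝ, ∀ x, ‖u T x‖ ≤ L)
    (l2DU : ∫⁻ x, ‖fderiv ℝ (u T) x‖ₑ ^ 2 < ⊤) :
    ¬ Tendsto (fun t : ℝ => (Real.sqrt (T - t))⁻¹ * ∫ x, ‖u t x - u T x‖ ^ 2) (𝓝[<] T) (𝓝 0) :=
  jolt_of_regularTerminalValue hν hT hmax hLH hdec hUs
    (isDivFree_terminalValue hT hLH (hUs.of_le (by norm_cast))) hL l2DU

/-- **`NoTerminalJolt ⇒ blow-ups leave ROUGH terminal profiles`** (the crux BY NAME, divergence-free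
hypothesis discharged): for every `ν, T > 0` and every MAXIMAL frame solution, the Leray–Hopf terminal
value `u(T)` is NOT a smooth bounded field with `Du(T) ∈ L²`. Conditional on the OPEN crux; nothing is
asserted about it or about the existence of blow-ups. [folklore] -/
theorem not_smoothTerminalValue_of_noTerminalJolt (h : Theses.QuarterJolt.NoTerminalJolt) :
    ∀ (ν T : ℝ), 0 < ν → 0 < T →
      ∀ (u : ℝ → EuclideanSpace ℝ (Fin 3) → EuclideanSpace ℝ (Fin 3))
        (p : ℝ → EuclideanSpace ℝ (Fin 3) → ℝ),
        Literature.Analysis.FluidPDE.IsMaximalSmoothSolution ν 0 u p T →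
        Literature.Analysis.FluidPDE.IsLerayHopfOn T ν 0 (u 0) u →
        Literature.Analysis.FluidPDE.HasRapidSpatialDecay (u 0) →
        ¬ (ContDiff ℝ ∞ (u T) ∧ (∃ L : ℝ, ∀ x, ‖u T x‖ ≤ L) ∧ ∫⁻ x, ‖fderiv ℝ (u T) x‖ₑ ^ 2 < ⊤) :=
  fun ν T hν hT u p hmax hLH hdec hreg =>
    jolt_of_smoothTerminalValue hν hT hmax hLH hdec hreg.1 hreg.2.1 hreg.2.2
      (h ν T hν hT u p hmax.1 hLH hdec)

end NoTerminalJolt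

end Summit.NavierStokesRegularity.NavierStokesRegularity.Theorems

end
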